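import Literature.Barriers.NavierStokesRegularity.NavierStokesInequalitySingularSolutions
import HarnessLib

/-!
# Barrier: «suitability is rate-blind» — a TYPE-II first-time blow-up inside the Navier–Stokes
# INEQUALITY class (super-self-similar re-gluing of Scheffer–Ożański's block)

Barrier catalogue entry for `NavierStokesRegularity` (D-0021), companion of
`NavierStokesInequalitySingularSolutions.lean` (`NavierStokesInequalitySingularSolution`: Scheffer's
singular weak NSI solution — an EXACTLY self-similar, hence Type-I, cascade) and of
`NavierStokesInequalitySingularSolutionsAllViscosities.lean` (`not_nsi_typeI_exclusion_viscosity`,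
`not_nsi_L3_criterion_viscosity`: no NSI-valid REGULARITY criterion of Type-I / bounded-`L³` type).
The present entry is DISTINCT from both: it kills RATE conclusions — statements of the form «a
first blow-up in the (suitable / Leray–Hopf-like) class is Type I» proved from the local-energy
axiomatics alone.

## What is printed, and what is derived (read before citing)

PRINTED (W. S. Ożański, *On weak solutions to the Navier–Stokes inequality with internal
singularities*, arXiv:1709.00602 [Ozanski2017NSISingular]; V. Scheffer, Comm. Math. Phys. 101
(1985) [Scheffer1985]; the modern definition of a weak NSI solution: Ożański, Comm. Math. Phys.
374 (2020), Def. 1.1 [Ozanski2019NSI] = the tree's `IsWeakNSISolution`):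
* a classical "block" `u ∈ C^∞(ℝ³ × [0,T])`, `supp u(t) = G` compact, `div u = 0`, obeying the
  POINTWISE Navier–Stokes inequality `∂ₜ|u|² ≤ −u·∇(|u|² + 2p) + 2ν u·Δu` for EVERY
  `ν ∈ [0, ν₀]` (Thm 4 p. 5; §4), with the self-focusing gain (4.2)
  `|u(Γx, T)| ≥ τ⁻¹ |u(x, 0)|`, `Γx = τx + z`, `Γ(G) ⊆ G` (tree: `IsNSIBlock`,
  `NavierStokesInequalitySwitching.lean`);
* the verification of (4.2) in §5.5 pp. 24–25 with the constants (5.16) `τ = 0.48ε`, (5.30)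
  `‖f₁‖_∞ ≤ μ/100`, `μ > 100`, (5.31) `T = (μ² − 5)/(1.1ε²B)`: Case 1
  `8TB ≥ (7.2/1.1)(μ/ε)² > (1.01/0.48)²(μ/ε)²`, Case 2 `0.01TB ≥ (0.009/1.1)(μ/ε)² > (0.01/0.48)²(μ/ε)²`
  — STRICT inequalities with multiplicative slack `1.478` resp. `18.8` (tree:
  `printed_constants`, `NavierStokesInequalityArrangementConclusion.lean`; the `K = 6/5` instance
  `printed_constants_margin` is kernel-checked Summit-side, see below);
* Scheffer's switching principle: rescaled copies glued at times where the magnitude DROPS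
  pointwise give a weak NSI solution (Scheffer 1985 Lemma 2.3; Ożański §3.1; tree:
  `isWeakNSISolution_of_piecewise`, `NavierStokesInequalityGluingWeak.lean`), and the printed
  cascade `u⁽ʲ⁾ = τ⁻ʲ u(Γ⁻ʲx, τ⁻²ʲ(t − tⱼ))` — NS scaling, amplitude ratio = space ratio⁻¹ =
  `τ⁻¹` — which is discretely self-similar about `(T₀, x₀)` and therefore of TYPE I
  (`‖𝔲(t)‖_∞ ≤ C(T₀ − t)^{−1/2}`; tree: `IsNSIBlock.norm_glue_le_div_sqrt`, `not_isTypeIIBlowup_glue`).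

DERIVED (ns-typeII-critic-1, K-READ 03 of the §B candidate «`NSIFirstBlowupIsTypeI`», 2026-08-26,
file `pub/ns-regularity-ideate/ns-typeII-critic-1/KREAD-03-NSIFirstBlowupIsTypeI.md` sha16
9f90792d380320f4; paper-level, every ingredient printed or a one-line scaling identity; kernel
anchors Summit-side in `Summits/…/Theorems/TypeIliouvilleNoTypeII/Negative/NSISuperSimilarSeed.lean`
(p470236): `printed_constants_margin`, `nsi_superPiece` — a Literature file cannot import them):
(i) the printed slack proves (4.2) with `τ⁻²` replaced by `K²τ⁻²` for every `K ≤ 1.2159`, and §4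
runs verbatim ⇒ the SAME block has SUPER-similar gain `|u(Γx,T)| ≥ Kτ⁻¹|u(x,0)|`, `K = 6/5`;
(ii) two-parameter covariance: `w(t,x) = a·U(ab·t, b·x)` is pointwise-NSI at viscosity `ν` iff `U`
is at `νb/a` (`≤ ν` when `b ≤ a`); (iii) the cascade with amplitude ratio `a = Kτ⁻¹` > space ratio
`b = τ⁻¹`, time ratio `θ = ab`: piece `j` is NSI at `ν₀` (effective viscosity `ν₀K⁻ʲ ∈ [0,ν₀]`),
drops at `t_{j+1}` by the `K`-gain, supports `Γʲ(G) ⊆ G`, and the energies / dissipations / cubic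
and pressure integrals are geometric sums (`(K²τ)ʲ`, `(Kτ)ʲ`, `(K²τ²)ʲ`, …; `K²τ < 1`), so the
switched field is a weak NSI solution at `ν₀` with `C^∞` compactly supported slices, bounded on
every `[0,T'] × ℝ³`, `T' < T₀ = lim tⱼ`; (iv) on the whole `j`-th piece
`‖𝔲(t)‖_∞ ≥ m₀ aʲ ≥ c (T₀ − t)^{−β}` with `β = ln a / ln θ = s/(s+1)`,
`s = 1 + ln K / ln τ⁻¹ > 1`, so `β > 1/2`: the blow-up at `T₀` is NOT Type I (and
`‖𝔲(t)‖_{L³} = Kʲ‖U‖₃ → ∞`).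

So the named fact below is NOT a printed theorem: it is the team's derivation of record from the
printed construction, vendored as ONE named fact (D-0026: the only new fact of this file; typing
(A) of the coordinator's spec `pub/ns-blowup/lit/NSITypeIIBlowup-BARRIER-SPEC.md`), with its
kernel DISCHARGE `NSITypeIIBlowup_holds` PENDING (bricks B1–B3 of K-READ 03 §6.3: a gain
parameter `g` through `IsNSIArrangement`/`NSIBlock_of_arrangement`, the `(a,b)`-glue
`Scheffer.glueG` with `isWeakNSISolution_glueG`, and `not_typeI_glueG`; natural home
`Theorems/TypeIliouvilleNoTypeII/Negative/NSITypeIIBlowupHolds.lean`). The `status:` field says so.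

## Contents

* FACT `NSITypeIIBlowup` — the barrier, in the `∀ ν ∈ Icc 0 ν₀` shape of
  `NavierStokesInequalitySingularSolution`, with the blow-up located at `T₀` (bounded on every
  `[0,T'] × ℝ³`, `T' < T₀`; a CKN-singular point `(T₀, x₀)`) and the RATE asserted only as
  `∃ β > 1/2, ∃ c > 0, ∀ t ∈ [0,T₀), ∃ x, ‖u(t,x)‖ ≥ c (T₀ − t)^{−β}` (no hard-wired `β`; the
  certified range is in `scope_caveats`).
* PROVED from it: `NSITypeIIBlowup.isTypeIIBlowup_form` (the informal headline: a weak NSI solution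
  for every `ν ∈ [0,ν₀]`, smooth compactly supported slices, bounded before `T₀`, with
  `IsTypeIIBlowup u T₀` — singular time and `¬ IsTypeIBlowup`), and the two NEGATION SHAPES §B
  candidates need: `NSITypeIIBlowup.not_nsiFirstBlowupIsTypeI` (the literal negation of candidate
  3's decl `NSIFirstBlowupIsTypeI` — a.e.-in-time Type-I conclusion — refuted by one `exact`) and
  `NSITypeIIBlowup.not_nsi_typeI_rate` (the `IsTypeIBlowup`-conclusion variant, every fixed
  `ν ∈ (0, ν₀]`). Arithmetic core: `exists_window_rate_beats_typeI` (for `β > 1/2`, close to `T₀`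
  the rate `c(T₀−t)^{−β}` beats every `C(T₀−t)^{−1/2}`).

## References

* W. S. Ożański, arXiv:1709.00602 (2017), Thm 4 (p. 5), §4 (Lemma 8, (4.13), Prop 9), §5.5
  pp. 24–25 ((5.16), (5.29)–(5.31)). [`Ozanski2017NSISingular`]
* V. Scheffer, Comm. Math. Phys. 101 (1985), 47–85, Lemma 2.3 and main theorem. [`Scheffer1985`]
* W. S. Ożański, Comm. Math. Phys. 374 (2020), Def. 1.1 (= arXiv:1809.02109). [`Ozanski2019NSI`]
-/

noncomputable section

open MeasureTheory Set Function Filter Topology TopologicalSpace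
open scoped ENNReal ContDiff

namespace Literature.Barriers.NavierStokesRegularity

/-- **Barrier «suitability is rate-blind»: the Navier–Stokes INEQUALITY class admits a Type-II
first-time blow-up.** There exist `ν₀ > 0`, a compact `K ⊆ ℝ³` and a pair `(u, p)` which is a
weak solution of the Navier–Stokes inequality on `ℝ³ × (0,∞)` (`IsWeakNSISolution`, Ożański 2020
Def. 1.1) for EVERY viscosity `ν ∈ [0, ν₀]`, with `C^∞` slices `u(t)`, `t ≥ 0`, supported in `K`,
and a time `T₀ > 0` and a point `x₀` such that: `(T₀, x₀)` is a singular point in the CKN sense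
(`¬ IsRegularPoint`), `u` is bounded on `[0, T'] × ℝ³` for every `T' < T₀` (so `T₀` is the FIRST
blow-up time), and the blow-up at `T₀` beats the self-similar rate: for some `β > 1/2` and
`c > 0`, at every time `t ∈ [0, T₀)` some point has `‖u(t,x)‖ ≥ c (T₀ − t)^{−β}` — in particular
`limsup_{t↑T₀} (T₀ − t)^{1/2}‖u(t)‖_∞ = ∞`, `¬ IsTypeIBlowup u T₀` (`isTypeIIBlowup_form`).
NOT PRINTED AS SUCH — see the module docstring: the printed cascade [cite: Scheffer1985, Lemma 2.3 and main theorem] [cite: Ozanski2017NSISingular, Thm 4 (p. 5), §4 and §5.5 pp. 24–25] is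
exactly self-similar (Type I); the Type-II variant re-glues the SAME printed block, whose gain
inequality (4.2) is verified in print with slack `1.478` [cite: Ozanski2017NSISingular, §5.5 (5.16), (5.29)–(5.31)], with amplitude ratio `(6/5)τ⁻¹` >
space ratio `τ⁻¹` (derivation of record: ns-typeII-critic-1, K-READ 03, 2026-08-26; kernel
anchors `printed_constants_margin`, `nsi_superPiece` in Summits-side `NSISuperSimilarSeed.lean`).
[cite: Ozanski2019NSI, Def. 1.1]

BARRIER (structured block, D-0021):
technique_class: typeII-rate-exclusion local-energy-inequality suitable-weak-solution-axiomatics energy-class riesz-pressure-law CKN-currency — any Type-II exclusion / Type-I-rate conclusion whose proof uses of the solution only ⟨the energy class `L^∞_t L²_x`, `∇u ∈ L²`, the local energy inequality with a (signed) defect, the Riesz pressure law `−Δp = ∂ᵢ∂ⱼ(uᵢuⱼ)`, incompressibility, smoothness and compact support of the slices before the blow-up time⟩, i.e. an argument valid for every weak solution of the Navier–Stokes inequality [cite: Ozanski2019NSI, Def. 1.1] (K-READ 03 §6.2).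
blocks: «first blow-ups of suitable / Leray–Hopf-class solutions are Type I» read in the NSI class — §B candidate 3 `NSIFirstBlowupIsTypeI` / route package SuitabilityRateDoor (KILLED, K-READ 03; the literal negation is `NSITypeIIBlowup.not_nsiFirstBlowupIsTypeI` below) —, and every pure «⇒ Type-I rate» / «⇒ no Type II» conclusion drawn from the local-energy/CKN currency alone (KILL-KIT rider M2′), including rate readings of the residual `NoTypeII` (stmt-NavierStokesRegularity-0056) that name no equation-specific structure [cite: Ozanski2017NSISingular, §2.1 (pp. 6–7)].
because: the super-self-similar Scheffer cascade (module docstring (i)–(iv)): the printed block's gain inequality (4.2) holds with margin, `8TB ≥ (7.2/1.1)(μ/ε)² > (1.01/0.48)²(μ/ε)²` [cite: Ozanski2017NSISingular, §5.5 (5.29)–(5.31)] (tree: `printed_constants`; `K = 6/5`: Summits-side `printed_constants_margin`), so the same block has gain `(6/5)τ⁻¹` at space ratio `τ`; rescaling `w = a·U(ab·t, b·x)` maps the pointwise NSI at viscosity `νb/a` to viscosity `ν` (Summits-side `nsi_superPiece`), so with `a = (6/5)τ⁻¹ > b = τ⁻¹` every piece is NSI for all `ν ∈ [0,ν₀]`,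 the pieces drop at the switching times, and the glued field is a weak NSI solution [cite: Scheffer1985, Lemma 2.3 and main theorem] [cite: Ozanski2017NSISingular, §3.1 and Thm 4 (p. 5)] (tree gluing principle `isWeakNSISolution_of_piecewise`); along it `(T₀−t)^{1/2}‖u(t)‖_∞ ≳ K^{j/2} → ∞` and `‖u(t)‖_{L³} → ∞`.
evasions_known: use the Navier–Stokes EQUATION — structure outside the class by definition: vorticity transport / stretching identities, backward uniqueness and unique continuation (the `L^∞_t L³_x` endpoint: the cascade has `‖u‖_{L³} → ∞`, while Scheffer's Type-I field keeps `L³` bounded [cite: Ozanski2017NSISingular, §2.1 (p. 7)]), the exact `u·∇u` algebra, harmonic-pressure control beyond the Riesz law, time regularity of Leray–Hopf solutions (every switched field jumps in `L²` at the switching times; cf. `evasions_known` of `NavierStokesInequalitySingularSolution`) [cite: Ozanski2019NSI, p. 3 and Thm. 1.7]; «β up to 3/5» (the energy-monotonicity ceiling `K²τ ≤ 1 ⇔ s ≤ 3/2 ⇔ β ≤ 3/5`, ns-typeII-critic-2 2026-08-26) would need a RE-DESIGNED arrangement with pumping ≫ fitting — OPEN, not in print and not asserted here.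
scope_caveats: (i) NSI ≠ NSE: nothing is asserted about solutions of the Navier–Stokes EQUATIONS [cite: Ozanski2019NSI, p. 4]; (ii) within Ożański's printed arrangement the admissible gain is `g·τ ≤ 1.28` (Case 1 needs `g < 2.67/ε` with `τ = 0.48ε`) [cite: Ozanski2017NSISingular, §5.5 (5.16), (5.29)–(5.31)], so the certified cascades have gain exponent `s = 1 + ln(gτ)/ln τ⁻¹ ≤ 1 + 0.25/ln(2.08/ε)` and rate `β = s/(s+1) ∈ (1/2, 1/2 + 0.06/ln(2.08/ε)]` — `β − 1/2 ≈ 10⁻²`, `β ≤ 0.512` at `ε ≤ 10⁻²` (ns-typeII-critic-1 PRECISION, 2026-08-26): MILDLY but genuinely Type II; the statement therefore asserts only `∃ β > 1/2`; (iii) one fixed compact support `K`, viscosities `ν ∈ [0, ν₀]` with `ν₀ > 0` small (rescaling as in `…SingularSolutionsAllViscosities` would give every `ν > 0`; not asserted here); blow-up at the cascade's accumulation time `T₀`, singular point in the essential (CKN) sense as in the companion entry; (iv) THE FACT IS A DERIVATION OF RECORD, NOT A PRINTED THEOREM AND NOT YET A TREE THEOREM: printed = the Type-I cascade and the block with its margin;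 derived = the `(a,b)`-re-gluing (K-READ 03); kernel-checked so far = the margin arithmetic and the two-parameter covariance (Summits-side p470236); the discharge `NSITypeIIBlowup_holds` (bricks B1–B3) is pending — consumers cite `(h : NSITypeIIBlowup)` and inherit exactly this trust base.
status: established as a paper-level derivation from printed ingredients (K-READ 03, unrefuted; kernel discharge pending) — NOT contested. -/
def NSITypeIIBlowup : Prop :=
  ∃ ν₀ : ℝ, 0 < ν₀ ∧
    ∃ (K : Set (EuclideanSpace ℝ (Fin 3)))
      (u : ℝ → EuclideanSpace ℝ (Fin 3) → EuclideanSpace ℝ (Fin 3))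
      (p : ℝ → EuclideanSpace ℝ (Fin 3) → ℝ),
      IsCompact K ∧ (∀ ν ∈ Icc (0 : ℝ) ν₀, IsWeakNSISolution ν u p) ∧
      (∀ t : ℝ, 0 ≤ t → ContDiff ℝ (∞ : ℕ∞ω) (u t) ∧ tsupport (u t) ⊆ K) ∧
      ∃ (T₀ : ℝ) (x₀ : EuclideanSpace ℝ (Fin 3)), 0 < T₀ ∧
        ¬ Literature.Analysis.FluidPDE.IsRegularPoint u (T₀, x₀) ∧
        (∀ T' : ℝ, T' < T₀ → ∃ M : ℝ, ∀ t ∈ Icc 0 T', ∀ x, ‖u t x‖ ≤ M) ∧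
        ∃ β c : ℝ, 1 / 2 < β ∧ 0 < c ∧
          ∀ t ∈ Ico 0 T₀, ∃ x, c * (T₀ - t) ^ (-β) ≤ ‖u t x‖

/-! ## Arithmetic core: a super-`1/2` rate beats every Type-I bound near the blow-up time -/

/-- If `c > 0`, `s > 0` and `C s^{β − 1/2} < c`, then `c s^{−β} ≤ C/√s` is impossible
(multiply by `s^β`). [folklore] -/
private theorem not_rate_le_typeI {β c C s : ℝ} (hs : 0 < s)
    (hsmall : C * s ^ (β - 1 / 2) < c) : ¬ c * s ^ (-β) ≤ C / Real.sqrt s := by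
  intro hle
  have hsβ : 0 < s ^ β := Real.rpow_pos_of_pos hs _
  have hL : c * s ^ (-β) * s ^ β = c := by
    rw [mul_assoc, ← Real.rpow_add hs, neg_add_cancel, Real.rpow_zero, mul_one]
  have hR : C / Real.sqrt s * s ^ β = C * s ^ (β - 1 / 2) := by
    rw [Real.sqrt_eq_rpow, Real.rpow_sub hs]
    ring
  have h := mul_le_mul_of_nonneg_right hle hsβ.le
  rw [hL, hR] at h
  linarith

/-- **Close to the blow-up time a super-`1/2` rate beats every Type-I bound**: for `β > 1/2`,
`c > 0`, any `C` and any `a < T₀` there is a final window `(T₀ − s, T₀) ⊆ (a, T₀)` on which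
`C (T₀ − t)^{β − 1/2} < c`. [folklore] -/
private theorem exists_window_rate_beats_typeI {β c T₀ a : ℝ} (hβ : 1 / 2 < β) (hc : 0 < c)
    (C : ℝ) (ha : a < T₀) :
    ∃ s : ℝ, 0 < s ∧ s ≤ T₀ - a ∧ ∀ t ∈ Ioo (T₀ - s) T₀, C * (T₀ - t) ^ (β - 1 / 2) < c := by
  have he : 0 < β - 1 / 2 := by linarith
  by_cases hC : C ≤ 0
  · refine ⟨T₀ - a, by linarith, le_rfl, fun t ht => ?_⟩
    have hpos : 0 ≤ (T₀ - t) ^ (β - 1 / 2) := Real.rpow_nonneg (by linarith [ht.2]) _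
    exact lt_of_le_of_lt (mul_nonpos_of_nonpos_of_nonneg hC hpos) hc
  · push Not at hC
    have hq : 0 < c / (2 * C) := div_pos hc (by linarith)
    set r : ℝ := (c / (2 * C)) ^ (β - 1 / 2)⁻¹ with hr_def
    have hr : 0 < r := Real.rpow_pos_of_pos hq _
    refine ⟨min (T₀ - a) r, lt_min (by linarith) hr, min_le_left _ _, fun t ht => ?_⟩
    have hst : 0 < T₀ - t := by linarith [ht.2]
    have hlt : T₀ - t < r := by linarith [ht.1, min_le_right (T₀ - a) r]
    have hpow : (T₀ - t) ^ (β - 1 / 2) < r ^ (β - 1 / 2) := Real.rpow_lt_rpow hst.le hlt he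
    have hre : r ^ (β - 1 / 2) = c / (2 * C) := by
      rw [hr_def, Real.rpow_inv_rpow hq.le he.ne']
    rw [hre] at hpow
    calc C * (T₀ - t) ^ (β - 1 / 2) < C * (c / (2 * C)) := by gcongr
      _ = c / 2 := by field_simp
      _ < c := by linarith

/-! ## Proved consequences of the fact -/

/-- A field with the super-`1/2` rate lower bound `∃ x, ‖u(t,x)‖ ≥ c (T₀ − t)^{−β}` for all
`t ∈ [0, T₀)`, `β > 1/2`, `c > 0`, `T₀ > 0`, is NOT of Type I at `T₀`
(`Literature.Analysis.FluidPDE.IsTypeIBlowup`: `‖u(t,x)‖ ≤ C/√(T₀−t)` for all `x` and all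
`t < T₀` close to `T₀`). [folklore] -/
private theorem not_isTypeIBlowup_of_rate {β c T₀ : ℝ}
    {u : ℝ → EuclideanSpace ℝ (Fin 3) → EuclideanSpace ℝ (Fin 3)}
    (hβ : 1 / 2 < β) (hc : 0 < c) (hT₀ : 0 < T₀)
    (hrate : ∀ t ∈ Ico 0 T₀, ∃ x, c * (T₀ - t) ^ (-β) ≤ ‖u t x‖) :
    ¬ Literature.Analysis.FluidPDE.IsTypeIBlowup u T₀ := by
  rintro ⟨C, hC⟩
  obtain ⟨l, hl, hsub⟩ := mem_nhdsLT_iff_exists_Ioo_subset.1 hC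
  have hl' : l < T₀ := hl
  have ha : max l 0 < T₀ := max_lt hl' hT₀
  obtain ⟨s, hs, hsa, hwin⟩ := exists_window_rate_beats_typeI hβ hc C ha
  set t : ℝ := T₀ - s / 2 with ht_def
  have ht₁ : t ∈ Ioo (T₀ - s) T₀ := ⟨by linarith, by linarith⟩
  have ht₂ : t ∈ Ioo l T₀ := ⟨by linarith [le_max_left l 0], by linarith⟩
  have ht₃ : t ∈ Ico 0 T₀ := ⟨by linarith [le_max_right l 0], by linarith⟩
  obtain ⟨x, hx⟩ := hrate t ht₃
  have hbound : ‖u t x‖ ≤ C / Real.sqrt (T₀ - t) := hsub ht₂ x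
  exact not_rate_le_typeI (by linarith [ht₁.2]) (hwin t ht₁) (hx.trans hbound)

/-- **The informal headline, in the tree's vocabulary**: the barrier yields a weak solution of the
Navier–Stokes inequality for every `ν ∈ [0, ν₀]`, `ν₀ > 0`, with `C^∞` slices supported in one
compact set, bounded on every `[0, T'] × ℝ³`, `T' < T₀`, with a **Type-II blow-up at `T₀`** in the
sense of `Literature.Analysis.FluidPDE.IsTypeIIBlowup` (singular time and `¬ IsTypeIBlowup`).
[cite: Ozanski2017NSISingular, §5.5 pp. 24–25 and Thm 4 (p. 5)] -/
theorem NSITypeIIBlowup.isTypeIIBlowup_form (h : NSITypeIIBlowup) :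
    ∃ ν₀ : ℝ, 0 < ν₀ ∧
      ∃ (K : Set (EuclideanSpace ℝ (Fin 3)))
        (u : ℝ → EuclideanSpace ℝ (Fin 3) → EuclideanSpace ℝ (Fin 3))
        (p : ℝ → EuclideanSpace ℝ (Fin 3) → ℝ),
        IsCompact K ∧ (∀ ν ∈ Icc (0 : ℝ) ν₀, IsWeakNSISolution ν u p) ∧
        (∀ t : ℝ, 0 ≤ t → ContDiff ℝ (∞ : ℕ∞ω) (u t) ∧ tsupport (u t) ⊆ K) ∧
        ∃ T₀ : ℝ, 0 < T₀ ∧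
          (∀ T' : ℝ, T' < T₀ → ∃ M : ℝ, ∀ t ∈ Icc 0 T', ∀ x, ‖u t x‖ ≤ M) ∧
          Literature.Analysis.FluidPDE.IsTypeIIBlowup u T₀ := by
  obtain ⟨ν₀, hν₀, K, u, p, hK, hsol, hslice, T₀, x₀, hT₀, hsing, hbdd, β, c, hβ, hc, hrate⟩ := h
  exact ⟨ν₀, hν₀, K, u, p, hK, hsol, hslice, T₀, hT₀, hbdd, ⟨x₀, hsing⟩,
    not_isTypeIBlowup_of_rate hβ hc hT₀ hrate⟩

/-- **Negation shape 1 (kills §B candidate 3 by one `exact`)**: the barrier refutes, LITERALLY,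
the decl `NSIFirstBlowupIsTypeI` of the route package SuitabilityRateDoor («every weak NSI
solution with `C^∞` slices on `[0,T)` and bounded on every `[0,T'] × ℝ³`, `T' < T`, obeys
`‖u(t,x)‖ ≤ C/√(T−t)` for a.e. `t` near `T`»): the cascade is bounded before `T₀` yet at EVERY
`t < T₀` beats `c(T₀−t)^{−β}`, `β > 1/2`, so the a.e. bound fails on a final window of positive
measure. (K-READ 03, ns-typeII-critic-1, 2026-08-26: KILL MODEL-CEX M2′.)
[cite: Ozanski2017NSISingular, §5.5 pp. 24–25 and Thm 4 (p. 5)] -/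
theorem NSITypeIIBlowup.not_nsiFirstBlowupIsTypeI (h : NSITypeIIBlowup) :
    ¬ (∀ (ν T : ℝ), 0 < ν → 0 < T →
        ∀ (u : ℝ → EuclideanSpace ℝ (Fin 3) → EuclideanSpace ℝ (Fin 3))
          (p : ℝ → EuclideanSpace ℝ (Fin 3) → ℝ),
          IsWeakNSISolution ν u p →
          (∀ t : ℝ, 0 ≤ t → t < T → ContDiff ℝ ∞ (u t)) →
          (∀ T' : ℝ, T' < T → ∃ M : ℝ, ∀ t ∈ Set.Icc 0 T', ∀ x, ‖u t x‖ ≤ M) →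
          ∃ C δ : ℝ, 0 < δ ∧ ∀ᵐ t : ℝ, t ∈ Set.Ioo (T - δ) T →
            ∀ x, ‖u t x‖ ≤ C / Real.sqrt (T - t)) := by
  intro hE
  obtain ⟨ν₀, hν₀, K, u, p, -, hsol, hslice, T₀, x₀, hT₀, -, hbdd, β, c, hβ, hc, hrate⟩ := h
  obtain ⟨C, δ, hδ, hae⟩ := hE ν₀ T₀ hν₀ hT₀ u p (hsol ν₀ ⟨hν₀.le, le_rfl⟩)
    (fun t ht _ => (hslice t ht).1) hbdd
  -- a final window of positive measure on which the rate beats `C/√(T₀ - t)`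
  have ha : max (T₀ - δ) 0 < T₀ := max_lt (by linarith) hT₀
  obtain ⟨s, hs, hsa, hwin⟩ := exists_window_rate_beats_typeI hβ hc C ha
  -- some time in the window satisfies the a.e. bound
  have hex : ∃ t ∈ Ioo (T₀ - s) T₀, ∀ x, ‖u t x‖ ≤ C / Real.sqrt (T₀ - t) := by
    by_contra hnone
    push Not at hnone
    have hnull : volume {t : ℝ | ¬ (t ∈ Set.Ioo (T₀ - δ) T₀ →
        ∀ x, ‖u t x‖ ≤ C / Real.sqrt (T₀ - t))} = 0 := ae_iff.1 hae
    have hsubset : Ioo (T₀ - s) T₀ ⊆ {t : ℝ | ¬ (t ∈ Set.Ioo (T₀ - δ) T₀ →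
        ∀ x, ‖u t x‖ ≤ C / Real.sqrt (T₀ - t))} := by
      intro t ht
      obtain ⟨x, hx⟩ := hnone t ht
      have hmem : t ∈ Set.Ioo (T₀ - δ) T₀ :=
        ⟨by linarith [ht.1, le_max_left (T₀ - δ) 0], ht.2⟩
      exact fun himp => (himp hmem x).not_gt hx
    have hzero : volume (Ioo (T₀ - s) T₀) = 0 := measure_mono_null hsubset hnull
    rw [Real.volume_Ioo] at hzero
    have : (0 : ℝ≥0∞) < ENNReal.ofReal (T₀ - (T₀ - s)) := ENNReal.ofReal_pos.2 (by linarith)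
    exact this.ne' hzero
  obtain ⟨t, ht, hbound⟩ := hex
  have ht₀ : t ∈ Ico 0 T₀ := ⟨by linarith [ht.1, le_max_right (T₀ - δ) 0], ht.2⟩
  obtain ⟨x, hx⟩ := hrate t ht₀
  exact not_rate_le_typeI (by linarith [ht.2]) (hwin t ht) (hx.trans (hbound x))

/-- **Negation shape 2 (the `IsTypeIBlowup`-conclusion variant, at every fixed viscosity
`ν ∈ (0, ν₀]`)**, in the binder style of `not_nsi_typeI_exclusion_viscosity`: it is FALSE that
every weak solution of the Navier–Stokes inequality with viscosity `ν`, with `C^∞` compactly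
supported slices and bounded on every `[0, T'] × ℝ³`, `T' < T`, blows up at most at the Type-I
rate at `T` (`IsTypeIBlowup u T`). [cite: Ozanski2017NSISingular, §5.5 pp. 24–25 and Thm 4 (p. 5)] -/
theorem NSITypeIIBlowup.not_nsi_typeI_rate (h : NSITypeIIBlowup) :
    ∃ ν₀ : ℝ, 0 < ν₀ ∧ ∀ ν ∈ Ioc (0 : ℝ) ν₀,
      ¬ (∀ (T : ℝ) (u : ℝ → EuclideanSpace ℝ (Fin 3) → EuclideanSpace ℝ (Fin 3))
          (p : ℝ → EuclideanSpace ℝ (Fin 3) → ℝ), 0 < T →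
          IsWeakNSISolution ν u p →
          (∀ t : ℝ, 0 ≤ t → ContDiff ℝ ∞ (u t) ∧ HasCompactSupport (u t)) →
          (∀ T' : ℝ, T' < T → ∃ M : ℝ, ∀ t ∈ Icc 0 T', ∀ x, ‖u t x‖ ≤ M) →
          Literature.Analysis.FluidPDE.IsTypeIBlowup u T) := by
  obtain ⟨ν₀, hν₀, K, u, p, hK, hsol, hslice, T₀, x₀, hT₀, -, hbdd, β, c, hβ, hc, hrate⟩ := h
  refine ⟨ν₀, hν₀, fun ν hν hN => ?_⟩
  refine not_isTypeIBlowup_of_rate hβ hc hT₀ hrate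
    (hN T₀ u p hT₀ (hsol ν ⟨hν.1.le, hν.2⟩) (fun t ht => ?_) hbdd)
  exact ⟨(hslice t ht).1, hK.of_isClosed_subset (isClosed_tsupport _) (hslice t ht).2⟩

end Literature.Barriers.NavierStokesRegularity
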